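import Summits.Ventures.LatticeQCDFlow.Exactness.ReversibleTauIntFloor
import HarnessLib

/-!
# The reversible-sampler `τ_int` floor for an ADMISSIBLE CLASS of observables (square-integrable, not only bounded)

HONEST FRAMING: exact (Metropolis-corrected) sampling algorithms for lattice gauge theory;
figures of merit are autocorrelation/cost numbers at stated couplings and volumes; no
continuum-physics claim.  (SCALAR calibration rung S0-A: not a gauge result.)

Venture `LatticeQCDFlow` (cell pub-lqcd), topic `Exactness`; FANOUT row 2 (`s0-phi4`).  NEW WORK of
the cell over Mathlib and the cell's `τ_int` vocabulary (`Scoring/CalibrationTruths.tauInt`).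
Nothing is cited as a fact.  Printed counterpart, NAMED ONLY: Madras–Slade 1993, *The Self-Avoiding
Walk*, Prop. 9.2.2 (p. 304): for a reversible chain and every nonconstant `g ∈ ℓ²(π)`,
`τ_int,g ≥ (1 + ρ_g(1))/(2(1 − ρ_g(1)))`.

## Why this file (row 2's leftover (α))

`Exactness/ReversibleTauIntFloor.lean` proves that floor for BOUNDED measurable observables: its
operator hypotheses (bdd / lin / symm / contr) quantify over "measurable with `|f| ≤ B`".  The
observables of critical slowing down — the magnetisation `M = Σ_x φ_x` of lattice φ⁴, the energy —
are unbounded but square-integrable.  Here the same elementary argument (pair positivity instead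
of the spectral theorem) is run for an arbitrary ADMISSIBLE CLASS `A` of observables, specified
only by closure properties; the bounded class, polynomial-envelope classes (`|f| ≤ B(1 + Σ|φ_w|)^p`)
and `L²`-type classes are instances, chosen by the lattice files that use this one.

## Setting

`(X, μ)` a measurable space with a measure, `w ≥ 0` a weight (the target `e^{−S}`), a predicate
`A` on observables `X → ℝ` and an operator `K` on observables, with the hypotheses (each explicit
in the theorem that needs it):
(int) `f, h ∈ A ⇒ f·h·w` integrable; (comb) `f, h ∈ A ⇒ f + c·h ∈ A`; (stab) `f ∈ A ⇒ K f ∈ A`;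
(lin) `K(f + c h) = K f + c K h` pointwise on `A`; (symm) `∫ (K f) h w = ∫ f (K h) w` on `A`
(detailed balance, integrated form); (contr) `∫ (K f)² w ≤ ∫ f² w` on `A` (every exact Markov
operator).  No measurability or positivity of `w` beyond `w ≥ 0` is used at this level.

## What is proved (namespace `RevOp`)

* `sq_integral_mul_le` — Cauchy–Schwarz `(∫ u v w)² ≤ (∫ u² w)(∫ v² w)` on `A` (discriminant);
* `iterate_mem`, `iterate_add_mul`, `iterate_symm` (`Kᵐ` is again symmetric on `A`),
  `iterate_contr` (`Kᵐ` is again a contraction), `two_time` (`∫ (Kᵐg)(Kᵏg) w = C(m+k)`);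
* `pair_nonneg` (`0 ≤ C_h(2m) + C_h(2m+1)`), `partial_sum_nonneg`, `tsum_nonneg`;
* **`tauInt_ge`** — for every `g ∈ A` whose normalised autocorrelation `ρ(n) = C(n)/C(0)`,
  `C(n) = ∫ g (Kⁿ g) w`, has a summable tail and `ρ(1) < 1`:
  `(1 + ρ(1))/(2(1 − ρ(1))) ≤ τ_int = ½ + Σ_{n≥1} ρ(n)`.

NOT CLAIMED: `ρ(1) < 1` or summability for any particular sampler (hypotheses); non-reversible
updates (ordered sweeps).  The bounded-class theorem `reversible_tauInt_ge` is the instance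
`A = {measurable, bounded}` (not re-derived here; both files stand).
-/

namespace Summit.Ventures.LatticeQCDFlow.Exactness

open Real MeasureTheory Filter Finset
open Summit.Ventures.LatticeQCDFlow.Scoring

namespace RevOp

variable {X : Type*} [MeasurableSpace X] {μ : Measure X} {w : X → ℝ} {A : (X → ℝ) → Prop}
  {K : (X → ℝ) → (X → ℝ)}

/-- Squares of admissible observables are `w`-integrable (from (int) with `h = f`). -/
theorem integrable_sq_mul
    (hAi : ∀ ⦃f h : X → ℝ⦄, A f → A h → Integrable (fun x => f x * h x * w x) μ)
    {f : X → ℝ} (hf : A f) : Integrable (fun x => f x ^ 2 * w x) μ :=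
  (hAi hf hf).congr (Eventually.of_forall fun x => by simp only [sq])

/-- **Cauchy–Schwarz in `L²(w)` on an admissible class**: `(∫ u v w)² ≤ (∫ u² w)(∫ v² w)`
(the discriminant of `t ↦ ∫ (u + t v)² w ≥ 0`; no measurability beyond (int) is used). -/
theorem sq_integral_mul_le (hw0 : ∀ x, 0 ≤ w x)
    (hAi : ∀ ⦃f h : X → ℝ⦄, A f → A h → Integrable (fun x => f x * h x * w x) μ)
    {u v : X → ℝ} (hu : A u) (hv : A v) :
    (∫ x, u x * v x * w x ∂μ) ^ 2 ≤ (∫ x, u x ^ 2 * w x ∂μ) * ∫ x, v x ^ 2 * w x ∂μ := by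
  have iuu := integrable_sq_mul hAi hu
  have ivv := integrable_sq_mul hAi hv
  have iuv := hAi hu hv
  set P := ∫ x, u x ^ 2 * w x ∂μ with hP
  set B := ∫ x, u x * v x * w x ∂μ with hB
  set D := ∫ x, v x ^ 2 * w x ∂μ with hD
  have key : ∀ t : ℝ, 0 ≤ D * (t * t) + 2 * B * t + P := by
    intro t
    have h0 : 0 ≤ ∫ x, (u x + t * v x) ^ 2 * w x ∂μ :=
      integral_nonneg fun x => mul_nonneg (sq_nonneg _) (hw0 x)
    have e1 : ∀ x, (u x + t * v x) ^ 2 * w x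
        = u x ^ 2 * w x + 2 * t * (u x * v x * w x) + t * t * (v x ^ 2 * w x) := fun x => by ring
    have i2 : Integrable (fun x => 2 * t * (u x * v x * w x)) μ := iuv.const_mul _
    have i3 : Integrable (fun x => t * t * (v x ^ 2 * w x)) μ := ivv.const_mul _
    have i12 : Integrable (fun x => u x ^ 2 * w x + 2 * t * (u x * v x * w x)) μ := iuu.add i2
    have e : ∫ x, (u x + t * v x) ^ 2 * w x ∂μ = P + 2 * t * B + t * t * D := by
      simp_rw [e1]
      rw [integral_add i12 i3, integral_add iuu i2, integral_const_mul, integral_const_mul]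
    rw [e] at h0
    linarith
  have hd := discrim_le_zero key
  rw [discrim] at hd
  nlinarith [hd]

omit [MeasurableSpace X] in
/-- Iterates of `K` map the admissible class to itself. -/
theorem iterate_mem (hAK : ∀ ⦃f : X → ℝ⦄, A f → A (K f)) :
    ∀ (n : ℕ) {f : X → ℝ}, A f → A (K^[n] f)
  | 0, _, hf => by simpa using hf
  | n + 1, _, hf => by
    rw [Function.iterate_succ_apply]
    exact iterate_mem hAK n (hAK hf)

omit [MeasurableSpace X] in
/-- Iterates of a linear operator are linear on the class: `Kⁿ(f + c h) = Kⁿ f + c Kⁿ h`. -/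
theorem iterate_add_mul (hAK : ∀ ⦃f : X → ℝ⦄, A f → A (K f))
    (hlin : ∀ ⦃f h : X → ℝ⦄ (c : ℝ), A f → A h →
      ∀ x, K (fun s => f s + c * h s) x = K f x + c * K h x) (c : ℝ) :
    ∀ (n : ℕ) {f h : X → ℝ}, A f → A h →
      ∀ x, (K^[n] (fun s => f s + c * h s)) x = (K^[n] f) x + c * (K^[n] h) x
  | 0, _, _, _, _ => by simp
  | n + 1, f, h, hf, hh => by
    intro x
    have e : K (fun s => f s + c * h s) = fun s => K f s + c * K h s := funext (hlin c hf hh)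
    rw [Function.iterate_succ_apply, Function.iterate_succ_apply, Function.iterate_succ_apply, e]
    exact iterate_add_mul hAK hlin c n (hAK hf) (hAK hh) x

/-- **Iterates are again symmetric** on the class: `∫ (Kᵐ f) h w = ∫ f (Kᵐ h) w`. -/
theorem iterate_symm (hAK : ∀ ⦃f : X → ℝ⦄, A f → A (K f))
    (hsymm : ∀ ⦃f h : X → ℝ⦄, A f → A h →
      ∫ x, K f x * h x * w x ∂μ = ∫ x, f x * K h x * w x ∂μ) :
    ∀ (m : ℕ) {f h : X → ℝ}, A f → A h →
      ∫ x, (K^[m] f) x * h x * w x ∂μ = ∫ x, f x * (K^[m] h) x * w x ∂μ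
  | 0, _, _, _, _ => by simp
  | m + 1, f, h, hf, hh => by
    rw [Function.iterate_succ_apply, iterate_symm hAK hsymm m (hAK hf) hh, hsymm hf (iterate_mem hAK m hh),
      ← Function.iterate_succ_apply' K m h]

/-- **Iterates are again contractions** on the class: `∫ (Kᵐ f)² w ≤ ∫ f² w`. -/
theorem iterate_contr (hAK : ∀ ⦃f : X → ℝ⦄, A f → A (K f))
    (hcontr : ∀ ⦃f : X → ℝ⦄, A f → ∫ x, K f x ^ 2 * w x ∂μ ≤ ∫ x, f x ^ 2 * w x ∂μ) :
    ∀ (m : ℕ) {f : X → ℝ}, A f → ∫ x, (K^[m] f) x ^ 2 * w x ∂μ ≤ ∫ x, f x ^ 2 * w x ∂μ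
  | 0, _, _ => by simp
  | m + 1, _, hf => by
    rw [Function.iterate_succ_apply]
    exact (iterate_contr hAK hcontr m (hAK hf)).trans (hcontr hf)

/-- **Two-time form** of a symmetric operator on the class: `∫ (Kᵐ g)(Kᵏ g) w = ∫ g (K^{m+k} g) w`. -/
theorem two_time (hAK : ∀ ⦃f : X → ℝ⦄, A f → A (K f))
    (hsymm : ∀ ⦃f h : X → ℝ⦄, A f → A h →
      ∫ x, K f x * h x * w x ∂μ = ∫ x, f x * K h x * w x ∂μ)
    {g : X → ℝ} (hg : A g) (m k : ℕ) :
    ∫ x, (K^[m] g) x * (K^[k] g) x * w x ∂μ = ∫ x, g x * (K^[m + k] g) x * w x ∂μ := by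
  rw [iterate_symm hAK hsymm m hg (iterate_mem hAK k hg), ← Function.iterate_add_apply]

/-- **PAIR POSITIVITY** on the class — the elementary substitute for the spectral theorem:
`0 ≤ ∫ h (K^{2m} h) w + ∫ h (K^{2m+1} h) w` (`= ‖Kᵐh‖² + ⟨Kᵐh, K Kᵐh⟩ ≥ ‖Kᵐh‖² − ‖Kᵐh‖‖K^{m+1}h‖`). -/
theorem pair_nonneg (hw0 : ∀ x, 0 ≤ w x)
    (hAi : ∀ ⦃f h : X → ℝ⦄, A f → A h → Integrable (fun x => f x * h x * w x) μ)
    (hAK : ∀ ⦃f : X → ℝ⦄, A f → A (K f))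
    (hsymm : ∀ ⦃f h : X → ℝ⦄, A f → A h →
      ∫ x, K f x * h x * w x ∂μ = ∫ x, f x * K h x * w x ∂μ)
    (hcontr : ∀ ⦃f : X → ℝ⦄, A f → ∫ x, K f x ^ 2 * w x ∂μ ≤ ∫ x, f x ^ 2 * w x ∂μ)
    {h : X → ℝ} (hh : A h) (m : ℕ) :
    0 ≤ (∫ x, h x * (K^[2 * m] h) x * w x ∂μ) + ∫ x, h x * (K^[2 * m + 1] h) x * w x ∂μ := by
  have hu := iterate_mem hAK m hh
  have hv := hAK hu
  rw [two_mul, ← two_time hAK hsymm hh m m, show m + m + 1 = m + (m + 1) by ring,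
    ← two_time hAK hsymm hh m (m + 1), Function.iterate_succ_apply' K m h]
  set u := K^[m] h with hu_def
  have hA0 : 0 ≤ ∫ x, u x ^ 2 * w x ∂μ := integral_nonneg fun x => mul_nonneg (sq_nonneg _) (hw0 x)
  have hA' := hcontr hu
  have hCS := sq_integral_mul_le hw0 hAi hu hv
  have hsq : (∫ x, u x * K u x * w x ∂μ) ^ 2 ≤ (∫ x, u x ^ 2 * w x ∂μ) ^ 2 := by
    calc (∫ x, u x * K u x * w x ∂μ) ^ 2
        ≤ (∫ x, u x ^ 2 * w x ∂μ) * ∫ x, K u x ^ 2 * w x ∂μ := hCS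
      _ ≤ (∫ x, u x ^ 2 * w x ∂μ) * ∫ x, u x ^ 2 * w x ∂μ := mul_le_mul_of_nonneg_left hA' hA0
      _ = (∫ x, u x ^ 2 * w x ∂μ) ^ 2 := by ring
  have habs := abs_le_of_sq_le_sq' hsq hA0
  have e : ∫ x, u x * u x * w x ∂μ = ∫ x, u x ^ 2 * w x ∂μ := by simp only [sq]
  rw [e]
  linarith [habs.1]

/-- Partial sums over whole pairs are nonnegative: `0 ≤ Σ_{n < 2N} ∫ h (Kⁿ h) w`. -/
theorem partial_sum_nonneg (hw0 : ∀ x, 0 ≤ w x)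
    (hAi : ∀ ⦃f h : X → ℝ⦄, A f → A h → Integrable (fun x => f x * h x * w x) μ)
    (hAK : ∀ ⦃f : X → ℝ⦄, A f → A (K f))
    (hsymm : ∀ ⦃f h : X → ℝ⦄, A f → A h →
      ∫ x, K f x * h x * w x ∂μ = ∫ x, f x * K h x * w x ∂μ)
    (hcontr : ∀ ⦃f : X → ℝ⦄, A f → ∫ x, K f x ^ 2 * w x ∂μ ≤ ∫ x, f x ^ 2 * w x ∂μ)
    {h : X → ℝ} (hh : A h) :
    ∀ N : ℕ, 0 ≤ ∑ n ∈ Finset.range (2 * N), ∫ x, h x * (K^[n] h) x * w x ∂μ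
  | 0 => by simp
  | N + 1 => by
    rw [show 2 * (N + 1) = 2 * N + 1 + 1 by ring, Finset.sum_range_succ, Finset.sum_range_succ]
    have h1 := partial_sum_nonneg hw0 hAi hAK hsymm hcontr hh N
    have h2 := pair_nonneg hw0 hAi hAK hsymm hcontr hh N
    linarith

/-- **The resolvent form is nonnegative** on the class: if `n ↦ ∫ h (Kⁿ h) w` is summable then
`0 ≤ Σ_{n ≥ 0} ∫ h (Kⁿ h) w`. -/
theorem tsum_nonneg (hw0 : ∀ x, 0 ≤ w x)
    (hAi : ∀ ⦃f h : X → ℝ⦄, A f → A h → Integrable (fun x => f x * h x * w x) μ)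
    (hAK : ∀ ⦃f : X → ℝ⦄, A f → A (K f))
    (hsymm : ∀ ⦃f h : X → ℝ⦄, A f → A h →
      ∫ x, K f x * h x * w x ∂μ = ∫ x, f x * K h x * w x ∂μ)
    (hcontr : ∀ ⦃f : X → ℝ⦄, A f → ∫ x, K f x ^ 2 * w x ∂μ ≤ ∫ x, f x ^ 2 * w x ∂μ)
    {h : X → ℝ} (hh : A h) (hs : Summable fun n => ∫ x, h x * (K^[n] h) x * w x ∂μ) :
    0 ≤ ∑' n, ∫ x, h x * (K^[n] h) x * w x ∂μ := by
  have ht := hs.hasSum.tendsto_sum_nat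
  have h2 : Tendsto (fun N : ℕ => 2 * N) atTop atTop :=
    tendsto_atTop_mono (fun N => Nat.le_mul_of_pos_left N two_pos) tendsto_id
  exact ge_of_tendsto' (ht.comp h2) fun N => partial_sum_nonneg hw0 hAi hAK hsymm hcontr hh N

/-- The autocovariances `C(n) = ∫ g (Kⁿ g) w` of an admissible `g` expand bilinearly along the test
observable `h = K g + c g`: `∫ h (Kⁿ h) w = C(n+2) + 2c C(n+1) + c² C(n)`. -/
theorem autocov_test_observable
    (hAi : ∀ ⦃f h : X → ℝ⦄, A f → A h → Integrable (fun x => f x * h x * w x) μ)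
    (hAK : ∀ ⦃f : X → ℝ⦄, A f → A (K f))
    (hlin : ∀ ⦃f h : X → ℝ⦄ (c : ℝ), A f → A h →
      ∀ x, K (fun s => f s + c * h s) x = K f x + c * K h x)
    (hsymm : ∀ ⦃f h : X → ℝ⦄, A f → A h →
      ∫ x, K f x * h x * w x ∂μ = ∫ x, f x * K h x * w x ∂μ)
    {g : X → ℝ} (hg : A g) (c : ℝ) (n : ℕ) :
    ∫ x, (K g x + c * g x) * (K^[n] (fun s => K g s + c * g s)) x * w x ∂μ
      = (∫ x, g x * (K^[n + 2] g) x * w x ∂μ) + 2 * c * (∫ x, g x * (K^[n + 1] g) x * w x ∂μ)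
        + c ^ 2 * ∫ x, g x * (K^[n] g) x * w x ∂μ := by
  have hKg := hAK hg
  have hn := iterate_mem hAK n hg
  have hn1 := iterate_mem hAK (n + 1) hg
  have hlinn := iterate_add_mul hAK hlin c n hKg hg
  have e : ∀ x, (K g x + c * g x) * (K^[n] (fun s => K g s + c * g s)) x * w x
      = K g x * (K^[n + 1] g) x * w x + c * (K g x * (K^[n] g) x * w x)
        + c * (g x * (K^[n + 1] g) x * w x) + c ^ 2 * (g x * (K^[n] g) x * w x) := by
    intro x
    rw [hlinn x, ← Function.iterate_succ_apply K n g]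
    ring
  rw [integral_congr_ae (Eventually.of_forall e)]
  have i1 : Integrable (fun x => K g x * (K^[n + 1] g) x * w x) μ := hAi hKg hn1
  have i2 : Integrable (fun x => c * (K g x * (K^[n] g) x * w x)) μ := (hAi hKg hn).const_mul _
  have i3 : Integrable (fun x => c * (g x * (K^[n + 1] g) x * w x)) μ := (hAi hg hn1).const_mul _
  have i4 : Integrable (fun x => c ^ 2 * (g x * (K^[n] g) x * w x)) μ := (hAi hg hn).const_mul _
  have i12 : Integrable (fun x => K g x * (K^[n + 1] g) x * w x
      + c * (K g x * (K^[n] g) x * w x)) μ := i1.add i2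
  have i123 : Integrable (fun x => K g x * (K^[n + 1] g) x * w x
      + c * (K g x * (K^[n] g) x * w x) + c * (g x * (K^[n + 1] g) x * w x)) μ := i12.add i3
  rw [integral_add i123 i4, integral_add i12 i3, integral_add i1 i2,
    integral_const_mul, integral_const_mul, integral_const_mul]
  have two := two_time hAK hsymm hg
  have e1 : ∫ x, K g x * (K^[n + 1] g) x * w x ∂μ = ∫ x, g x * (K^[n + 2] g) x * w x ∂μ := by
    have := two 1 (n + 1)
    simp only [Function.iterate_one] at this
    rw [this, show 1 + (n + 1) = n + 2 by ring]
  have e2 : ∫ x, K g x * (K^[n] g) x * w x ∂μ = ∫ x, g x * (K^[n + 1] g) x * w x ∂μ := by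
    have := two 1 n
    simp only [Function.iterate_one] at this
    rw [this, show 1 + n = n + 1 by ring]
  rw [e1, e2]
  ring

/-- **THE `τ_int` FLOOR FOR A REVERSIBLE SAMPLER ON AN ADMISSIBLE CLASS (Madras–Slade Prop. 9.2.2,
general state space, square-integrable observables, elementary).**  `g ∈ A`,
`C(n) = ∫ g (Kⁿ g) w`, `ρ(n) = C(n)/C(0)`.  If the autocorrelation series is summable and
`ρ(1) < 1`, then `τ_int = ½ + Σ_{n≥1} ρ(n) ≥ (1 + ρ(1))/(2(1 − ρ(1)))`.
Proof: `tsum_nonneg` for `h = K g − ρ(1) g` reads `0 ≤ (1 − ρ)(S(1 − ρ) − C(1))`,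
`S = Σ_{n≥1} C(n)`. -/
theorem tauInt_ge (hw0 : ∀ x, 0 ≤ w x)
    (hAi : ∀ ⦃f h : X → ℝ⦄, A f → A h → Integrable (fun x => f x * h x * w x) μ)
    (hAc : ∀ ⦃f h : X → ℝ⦄ (c : ℝ), A f → A h → A (fun x => f x + c * h x))
    (hAK : ∀ ⦃f : X → ℝ⦄, A f → A (K f))
    (hlin : ∀ ⦃f h : X → ℝ⦄ (c : ℝ), A f → A h →
      ∀ x, K (fun s => f s + c * h s) x = K f x + c * K h x)
    (hsymm : ∀ ⦃f h : X → ℝ⦄, A f → A h →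
      ∫ x, K f x * h x * w x ∂μ = ∫ x, f x * K h x * w x ∂μ)
    (hcontr : ∀ ⦃f : X → ℝ⦄, A f → ∫ x, K f x ^ 2 * w x ∂μ ≤ ∫ x, f x ^ 2 * w x ∂μ)
    {g : X → ℝ} (hg : A g)
    (hs : Summable fun n => (∫ x, g x * (K^[n + 1] g) x * w x ∂μ) / ∫ x, g x ^ 2 * w x ∂μ)
    (hρ : (∫ x, g x * K g x * w x ∂μ) / (∫ x, g x ^ 2 * w x ∂μ) < 1) :
    (1 + (∫ x, g x * K g x * w x ∂μ) / ∫ x, g x ^ 2 * w x ∂μ)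
        / (2 * (1 - (∫ x, g x * K g x * w x ∂μ) / ∫ x, g x ^ 2 * w x ∂μ))
      ≤ tauInt (fun n => (∫ x, g x * (K^[n] g) x * w x ∂μ) / ∫ x, g x ^ 2 * w x ∂μ) := by
  -- notation
  set a : ℕ → ℝ := fun n => ∫ x, g x * (K^[n] g) x * w x ∂μ with ha
  set P := ∫ x, g x ^ 2 * w x ∂μ with hP
  set ρ := (∫ x, g x * K g x * w x ∂μ) / P with hρdef
  have hP0 : 0 ≤ P := integral_nonneg fun x => mul_nonneg (sq_nonneg _) (hw0 x)
  have ha0 : a 0 = P := by simp only [ha, hP, Function.iterate_zero, id_eq, sq]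
  have ha1 : a 1 = ∫ x, g x * K g x * w x ∂μ := by simp only [ha, Function.iterate_one]
  -- the test observable `h = K g − ρ g`
  have hKg := hAK hg
  have hh : A (fun s => K g s + (-ρ) * g s) := hAc (-ρ) hKg hg
  have hb : ∀ n, ∫ x, (K g x + (-ρ) * g x) * (K^[n] (fun s => K g s + (-ρ) * g s)) x * w x ∂μ
      = a (n + 2) - 2 * ρ * a (n + 1) + ρ ^ 2 * a n := by
    intro n
    rw [autocov_test_observable hAi hAK hlin hsymm hg (-ρ) n]
    simp only [ha]
    ring
  -- summability of the `a`-tail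
  have hsa : Summable fun n => a (n + 1) := by
    rcases eq_or_lt_of_le hP0 with hz | hpos
    · have hzero : ∀ n, a (n + 1) = 0 := by
        intro n
        have hcs := sq_integral_mul_le hw0 hAi hg (iterate_mem hAK (n + 1) hg)
        rw [← hP, ← hz, zero_mul] at hcs
        exact pow_eq_zero_iff (n := 2) (by norm_num) |>.1 (le_antisymm hcs (sq_nonneg _))
      exact summable_zero.congr fun n => (hzero n).symm
    · have := hs.mul_left P
      refine this.congr fun n => ?_
      simp only [ha]
      field_simp
  have h2s : Summable fun n => a (n + 2) :=
    (summable_nat_add_iff 1).2 hsa |>.congr fun n => by simp only [Nat.add_assoc]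
  have h0s : Summable fun n => a n := (summable_nat_add_iff 1).1 hsa
  have hsb : Summable fun n =>
      ∫ x, (K g x + (-ρ) * g x) * (K^[n] (fun s => K g s + (-ρ) * g s)) x * w x ∂μ := by
    simp_rw [hb]
    exact (h2s.sub (hsa.mul_left (2 * ρ))).add (h0s.mul_left (ρ ^ 2))
  have hpos := tsum_nonneg hw0 hAi hAK hsymm hcontr hh hsb
  set S := ∑' n, a (n + 1) with hS
  have hS2 : ∑' n, a (n + 2) = S - a 1 := by
    have := hsa.sum_add_tsum_nat_add 1
    simp only [Finset.sum_range_one] at this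
    rw [hS, ← this]
    ring_nf
  have hS0 : ∑' n, a n = a 0 + S := by
    have := h0s.sum_add_tsum_nat_add 1
    simp only [Finset.sum_range_one] at this
    rw [hS, ← this]
  have hsum_b : ∑' n, ∫ x, (K g x + (-ρ) * g x) * (K^[n] (fun s => K g s + (-ρ) * g s)) x * w x ∂μ
      = (S - a 1) - 2 * ρ * S + ρ ^ 2 * (a 0 + S) := by
    simp_rw [hb]
    rw [(h2s.sub (hsa.mul_left (2 * ρ))).tsum_add (h0s.mul_left (ρ ^ 2)),
      h2s.tsum_sub (hsa.mul_left (2 * ρ)), tsum_mul_left, tsum_mul_left, hS2, hS0]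
  rw [hsum_b] at hpos
  -- `τ_int = ½ + S/P`
  have htau : tauInt (fun n => (∫ x, g x * (K^[n] g) x * w x ∂μ) / ∫ x, g x ^ 2 * w x ∂μ)
      = 1 / 2 + S / P := by
    simp only [tauInt]
    rw [tsum_div_const]
  rw [htau]
  rcases eq_or_lt_of_le hP0 with hz | hPpos
  · have hρ0 : ρ = 0 := by rw [hρdef, ← hz, div_zero]
    rw [hρ0, ← hz, div_zero]
    norm_num
  · have hρP : ρ * P = a 1 := by
      rw [hρdef, ha1]
      field_simp
    have e1 : S - a 1 - 2 * ρ * S + ρ ^ 2 * (a 0 + S) = (1 - ρ) * (S * (1 - ρ) - a 1) := by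
      rw [ha0]
      have : ρ ^ 2 * P = ρ * a 1 := by rw [← hρP]; ring
      linear_combination this
    rw [e1] at hpos
    have h1ρ : 0 < 1 - ρ := by linarith
    have hkey : 0 ≤ S * (1 - ρ) - a 1 := (mul_nonneg_iff_of_pos_left h1ρ).1 hpos
    have hSP : ρ / (1 - ρ) ≤ S / P := by
      rw [div_le_div_iff₀ h1ρ hPpos]
      nlinarith [hρP, hkey]
    have e2 : (1 + ρ) / (2 * (1 - ρ)) = 1 / 2 + ρ / (1 - ρ) := by
      field_simp
      ring
    rw [e2]
    linarith

end RevOp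

end Summit.Ventures.LatticeQCDFlow.Exactness
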